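import Summits.CriticalPhenomena.PercolationContinuityZ3.Theses.PercShatteringRace
import Literature.Probability.Percolation.SharpnessDCTProofs
import Literature.Probability.Percolation.ConnectivityProofs
import Literature.Probability.Percolation.InequalitiesProofs
import Literature.Probability.Percolation.PercolationProofs
import HarnessLib

/-!
# Route PercShatteringRace — support `RaceLemma` (stmt-CriticalPhenomena-5788)

The card's race lemma for ALL admissible exponents: for real `a, b` with `0 < b` and
`(1 + b) (3 - a) < 3`, the free-box susceptibility power saving
`S(a) : Σ_{y ∈ Λ_R} P_{p_c}(0 ↔ y inside Λ_R) ≤ C R^{3-a}` (`R ≥ 1`) and the two-cluster decay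
`U(b)` at aspect `R = ⌈n^{1+b}⌉` together force `θ(p_c) = 0` on `ℤ³`, i.e.
`PercolationContinuityZ3`.

Proof (as on the item; bond percolation on `ℤ³` at `p_c`, measure `P = bondPercolation (zdGraph 3)
(criticalProbI 3)`):

* `exists_openConnIn_innerBoundary_of_percolatesAt` — deterministic first-exit core: for a lattice
  configuration `ω ⊆ E(ℤ^d)`, if `x ∈ Λ_R` has an infinite open cluster then `x` is joined INSIDE
  `Λ_R` to a vertex of the inner vertex boundary `∂ⁱⁿΛ_R` (stop an open path leaving the box at its
  first exit).
* `theta_sq_le_real_openConnIn_add_real_twoClusters` — for `x, x' ∈ Λ_r ⊆ Λ_R`: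
  `θ(p)² = θ_x θ_{x'} ≤ P(|C(x)| = ∞, |C(x')| = ∞)` (translation invariance + Harris–FKG) and, a.s.,
  on that event either `x ↔ x'` inside `Λ_R` or the two-cluster event of `(Λ_r, Λ_R)` occurs
  (witnesses `x, x'` and their first exits), so `θ(p)² ≤ P(x ↔ x' in Λ_R) + P(two clusters)`.
  No uniqueness of the infinite cluster is used.
* `raceLemma_proof` — if `θ := θ(p_c) ≠ 0` then `θ > 0`; by `U(b)`, eventually
  `P(two clusters) < θ²/2`, hence `P(0 ↔ x' in Λ_R) ≥ θ²/2` for every `x' ∈ Λ_n`,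
  `R = ⌈n^{1+b}⌉₊ ≥ n`; summing, `Σ_{y ∈ Λ_R} P(0 ↔ y in Λ_R) ≥ (2n+1)³ θ²/2 ≥ n³ θ²/2`, while
  `S(a)` bounds the sum by `C R^{3-a} ≤ K n^s` with `s = max-free case split`:
  `s = 0`, `K = |C|` if `3 - a ≤ 0` (`R ≥ 1`), and `s = (1+b)(3-a) < 3`, `K = |C| 2^{3-a}` otherwise
  (`R ≤ 2 n^{1+b}`); `n^{3-s} → ∞` gives the contradiction.

Tree inputs: `PathIn.exit`, `DCT16.pathIn_univ_of_reachable`, `DCT16.adj_of_openGraph_adj`,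
`DCT16.mem_openConnIn_iff_pathIn`, `DCT16.real_mono_of_forall_subset_edgeSet`
(`SharpnessDCTProofs.lean`), `harris_fkg_holds` (`InequalitiesProofs.lean`),
`isUpperSet_percolatesAt` (`PercolationEvents.lean`), `measurableSet_percolatesAt_holds`
(`PercolationProofs.lean`), `theta_zdGraph_eq_theta_zero` (`ConnectivityProofs.lean`),
`card_box`, `box_mono` (`ThermodynamicLimit.lean`).
-/

noncomputable section

namespace Summit.CriticalPhenomena.PercolationContinuityZ3.Theorems

open MeasureTheory Filter Literature.Probability.Percolation Literature.Probability.LatticeModels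
open scoped Topology

/-- **First exit of an infinite cluster from a box.** For a lattice configuration `ω ⊆ E(ℤ^d)`
and a site `x ∈ Λ_R = box d R` whose open cluster is infinite, `x` is joined inside `Λ_R` by an
open path to some vertex of the inner vertex boundary `∂ⁱⁿΛ_R`: an open path from `x` to a
vertex of the (unbounded) cluster outside `Λ_R`, stopped at its first exit from `Λ_R`, ends at a
vertex of `Λ_R` with a lattice neighbour outside. (Grimmett 1999, §1.4, `θ(p) ≤ P_p(0 ↔ ∂B(n))`,
here for an arbitrary starting vertex of the box.) -/
theorem exists_openConnIn_innerBoundary_of_percolatesAt {d R : ℕ} {x : Site d}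
    (hx : x ∈ box d R) {ω : BondConfig (Site d)} (hω : ω ⊆ (zdGraph d).edgeSet)
    (h : ω ∈ percolatesAt x) :
    ∃ y ∈ innerBoundary (zdGraph d) (box d R),
      ω ∈ openConnIn (↑(box d R) : Set (Site d)) x y := by
  classical
  have hnot : ¬ (openCluster ω x ⊆ (↑(box d R) : Set (Site d))) :=
    fun hsub => h ((box d R).finite_toSet.subset hsub)
  obtain ⟨z, hz, hzR⟩ := Set.not_subset.1 hnot
  have hpath : PathIn (openGraph ω) Set.univ x z := DCT16.pathIn_univ_of_reachable hz
  obtain ⟨a, c, ha, hc, -, hac, hpa⟩ :=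
    hpath.exit (R := (↑(box d R) : Set (Site d))) (Finset.mem_coe.2 hx) hzR
  refine ⟨a, ?_, ?_⟩
  · rw [mem_innerBoundary_iff]
    exact ⟨Finset.mem_coe.1 ha, c, fun h' => hc (Finset.mem_coe.2 h'),
      DCT16.adj_of_openGraph_adj hω hac⟩
  · rw [DCT16.mem_openConnIn_iff_pathIn]
    exact hpa.mono Set.inter_subset_left

/-- **`θ(p)² ≤ P_p(x ↔ x' in Λ_R) + P_p(two clusters)`** for bond percolation on `ℤ^d`, any `p`,
`r ≤ R` and `x, x' ∈ Λ_r`: by translation invariance and Harris–FKG,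
`θ(p)² = θ_x(p) θ_{x'}(p) ≤ P_p(|C(x)| = ∞, |C(x')| = ∞)`; and for a lattice configuration in the
latter event, either `x ↔ x'` inside `Λ_R`, or — taking the first exits from `Λ_R` of the two
infinite clusters — the configuration restricted to `Λ_R` contains two distinct open clusters each
meeting `Λ_r` and `∂ⁱⁿΛ_R` (the two-cluster event of `(Λ_r, Λ_R)`, witnesses `x, x'`). A union
bound concludes. No uniqueness of the infinite cluster is used. (The `r5 ⇒ r4` step of the route
at `p = p_c`; Grimmett 1999 §8.5 p. 213 for the FKG step.) -/
theorem theta_sq_le_real_openConnIn_add_real_twoClusters {d : ℕ} (p : unitInterval) {r R : ℕ}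
    (hrR : r ≤ R) {x x' : Site d} (hx : x ∈ box d r) (hx' : x' ∈ box d r) :
    theta (zdGraph d) 0 p ^ 2 ≤
      (bondPercolation (zdGraph d) p).real (openConnIn (↑(box d R) : Set (Site d)) x x') +
        (bondPercolation (zdGraph d) p).real {ω | ∃ x ∈ box d r, ∃ x' ∈ box d r,
          ∃ y ∈ innerBoundary (zdGraph d) (box d R), ∃ y' ∈ innerBoundary (zdGraph d) (box d R),
            ω ∈ openConnIn (↑(box d R) : Set (Site d)) x y ∧
              ω ∈ openConnIn (↑(box d R) : Set (Site d)) x' y' ∧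
                ω ∉ openConnIn (↑(box d R) : Set (Site d)) x x'} := by
  calc theta (zdGraph d) 0 p ^ 2 = theta (zdGraph d) x p * theta (zdGraph d) x' p := by
        rw [sq, theta_zdGraph_eq_theta_zero p x, theta_zdGraph_eq_theta_zero p x']
    _ ≤ (bondPercolation (zdGraph d) p).real (percolatesAt x ∩ percolatesAt x') :=
        harris_fkg_holds (zdGraph d) p (isUpperSet_percolatesAt x) (isUpperSet_percolatesAt x')
          (measurableSet_percolatesAt_holds x) (measurableSet_percolatesAt_holds x')
    _ ≤ (bondPercolation (zdGraph d) p).real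
          (openConnIn (↑(box d R) : Set (Site d)) x x' ∪ {ω | ∃ x ∈ box d r, ∃ x' ∈ box d r,
            ∃ y ∈ innerBoundary (zdGraph d) (box d R), ∃ y' ∈ innerBoundary (zdGraph d) (box d R),
              ω ∈ openConnIn (↑(box d R) : Set (Site d)) x y ∧
                ω ∈ openConnIn (↑(box d R) : Set (Site d)) x' y' ∧
                  ω ∉ openConnIn (↑(box d R) : Set (Site d)) x x'}) := by
        refine DCT16.real_mono_of_forall_subset_edgeSet (zdGraph d) p fun ω hω hmem => ?_
        by_cases hc : ω ∈ openConnIn (↑(box d R) : Set (Site d)) x x'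
        · exact Or.inl hc
        · obtain ⟨y, hy, hxy⟩ :=
            exists_openConnIn_innerBoundary_of_percolatesAt (box_mono d hrR hx) hω hmem.1
          obtain ⟨y', hy', hxy'⟩ :=
            exists_openConnIn_innerBoundary_of_percolatesAt (box_mono d hrR hx') hω hmem.2
          exact Or.inr ⟨x, hx, x', hx', y, hy, y', hy', hxy, hxy', hc⟩
    _ ≤ _ := measureReal_union_le _ _

/-- **The race lemma** (item `stmt-CriticalPhenomena-5788`, route PercShatteringRace, exact
signature): for real `a, b` with `0 < b` and `(1 + b) (3 - a) < 3`, the power saving `S(a)` for the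
free-box susceptibility of the centre of `Λ_R ⊆ ℤ³` at `p_c` and the two-cluster decay `U(b)` at
aspect `⌈n^{1+b}⌉` imply `θ(p_c) = 0` on `ℤ³` (`PercolationContinuityZ3`). If `θ(p_c) > 0`,
`U(b)` and `theta_sq_le_real_openConnIn_add_real_twoClusters` give
`P(0 ↔ y in Λ_R) ≥ θ²/2` for all `y ∈ Λ_n`, `R = ⌈n^{1+b}⌉₊`, `n` large, so the free-box
susceptibility is `≥ (2n+1)³ θ²/2 ≥ n³ θ²/2`, against `S(a)`'s `C R^{3-a} ≤ K n^s` with `s < 3`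
(`s = 0` if `3 - a ≤ 0`, else `s = (1+b)(3-a)` using `R ≤ 2 n^{1+b}`); `n^{3-s} → ∞`. -/
theorem raceLemma_proof :
    Summit.CriticalPhenomena.PercolationContinuityZ3.Theses.PercShatteringRace.RaceLemma := by
  unfold Summit.CriticalPhenomena.PercolationContinuityZ3.Theses.PercShatteringRace.RaceLemma
  intro a b hb hab hS hU
  by_contra hne
  have hθ : 0 < theta (zdGraph 3) (0 : Site 3) (criticalProbI 3) :=
    lt_of_le_of_ne measureReal_nonneg (Ne.symm hne)
  set μ := bondPercolation (zdGraph 3) (criticalProbI 3) with hμ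
  set θ := theta (zdGraph 3) (0 : Site 3) (criticalProbI 3) with hθdef
  obtain ⟨C, hC⟩ := hS
  have hθ2 : 0 < θ ^ 2 / 2 := by positivity
  -- `U(b)`: eventually the two-cluster event has probability `< θ² / 2`
  obtain ⟨N, hN⟩ := (hU.eventually (gt_mem_nhds hθ2)).exists_forall_of_atTop
  -- the exponent race: `C R^{3-a} ≤ K n^s` with `s < 3`
  obtain ⟨K, s, hs3, hK⟩ : ∃ K s : ℝ, s < 3 ∧ ∀ n : ℕ, 1 ≤ n →
      C * ((⌈(n : ℝ) ^ (1 + b)⌉₊ : ℕ) : ℝ) ^ (3 - a) ≤ K * (n : ℝ) ^ s := by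
    rcases le_or_gt (3 - a) 0 with ha | ha
    · refine ⟨|C|, 0, by norm_num, fun n hn => ?_⟩
      have hn1 : (1 : ℝ) ≤ n := by exact_mod_cast hn
      have hR1 : (1 : ℝ) ≤ ((⌈(n : ℝ) ^ (1 + b)⌉₊ : ℕ) : ℝ) := by
        have h1 : (1 : ℝ) ≤ (n : ℝ) ^ (1 + b) := Real.one_le_rpow hn1 (by linarith)
        exact h1.trans (Nat.le_ceil _)
      have hle1 : ((⌈(n : ℝ) ^ (1 + b)⌉₊ : ℕ) : ℝ) ^ (3 - a) ≤ 1 :=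
        Real.rpow_le_one_of_one_le_of_nonpos hR1 ha
      have hnn : 0 ≤ ((⌈(n : ℝ) ^ (1 + b)⌉₊ : ℕ) : ℝ) ^ (3 - a) :=
        Real.rpow_nonneg (by positivity) _
      rw [Real.rpow_zero, mul_one]
      calc C * ((⌈(n : ℝ) ^ (1 + b)⌉₊ : ℕ) : ℝ) ^ (3 - a)
          ≤ |C| * ((⌈(n : ℝ) ^ (1 + b)⌉₊ : ℕ) : ℝ) ^ (3 - a) :=
            mul_le_mul_of_nonneg_right (le_abs_self C) hnn
        _ ≤ |C| * 1 := mul_le_mul_of_nonneg_left hle1 (abs_nonneg C)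
        _ = |C| := mul_one _
    · refine ⟨|C| * (2 : ℝ) ^ (3 - a), (1 + b) * (3 - a), hab, fun n hn => ?_⟩
      have hn1 : (1 : ℝ) ≤ n := by exact_mod_cast hn
      have hn0 : (0 : ℝ) ≤ n := by positivity
      have hpow1 : (1 : ℝ) ≤ (n : ℝ) ^ (1 + b) := Real.one_le_rpow hn1 (by linarith)
      have hpow0 : (0 : ℝ) ≤ (n : ℝ) ^ (1 + b) := zero_le_one.trans hpow1
      have hR2 : ((⌈(n : ℝ) ^ (1 + b)⌉₊ : ℕ) : ℝ) ≤ 2 * (n : ℝ) ^ (1 + b) := by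
        have := Nat.ceil_lt_add_one hpow0
        linarith
      have hR0 : (0 : ℝ) ≤ ((⌈(n : ℝ) ^ (1 + b)⌉₊ : ℕ) : ℝ) := by positivity
      have hRpow : ((⌈(n : ℝ) ^ (1 + b)⌉₊ : ℕ) : ℝ) ^ (3 - a) ≤
          (2 : ℝ) ^ (3 - a) * (n : ℝ) ^ ((1 + b) * (3 - a)) := by
        calc ((⌈(n : ℝ) ^ (1 + b)⌉₊ : ℕ) : ℝ) ^ (3 - a)
            ≤ (2 * (n : ℝ) ^ (1 + b)) ^ (3 - a) := Real.rpow_le_rpow hR0 hR2 ha.le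
          _ = (2 : ℝ) ^ (3 - a) * ((n : ℝ) ^ (1 + b)) ^ (3 - a) :=
              Real.mul_rpow (by norm_num) hpow0
          _ = (2 : ℝ) ^ (3 - a) * (n : ℝ) ^ ((1 + b) * (3 - a)) := by
              rw [← Real.rpow_mul hn0]
      have hnn : 0 ≤ ((⌈(n : ℝ) ^ (1 + b)⌉₊ : ℕ) : ℝ) ^ (3 - a) := Real.rpow_nonneg hR0 _
      calc C * ((⌈(n : ℝ) ^ (1 + b)⌉₊ : ℕ) : ℝ) ^ (3 - a)
          ≤ |C| * ((⌈(n : ℝ) ^ (1 + b)⌉₊ : ℕ) : ℝ) ^ (3 - a) :=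
            mul_le_mul_of_nonneg_right (le_abs_self C) hnn
        _ ≤ |C| * ((2 : ℝ) ^ (3 - a) * (n : ℝ) ^ ((1 + b) * (3 - a))) :=
            mul_le_mul_of_nonneg_left hRpow (abs_nonneg C)
        _ = |C| * (2 : ℝ) ^ (3 - a) * (n : ℝ) ^ ((1 + b) * (3 - a)) := by ring
  -- for large `n`, the free-box susceptibility at scale `R = ⌈n^{1+b}⌉₊` is `≥ (2n+1)³ θ²/2`
  have hmain : ∀ n : ℕ, N ≤ n → 1 ≤ n →
      (((2 * n + 1) ^ 3 : ℕ) : ℝ) * (θ ^ 2 / 2) ≤ K * (n : ℝ) ^ s := by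
    intro n hNn hn
    set R : ℕ := ⌈(n : ℝ) ^ (1 + b)⌉₊ with hR
    have hn1 : (1 : ℝ) ≤ n := by exact_mod_cast hn
    have hnR : n ≤ R := by
      have h1 : (n : ℝ) ≤ (n : ℝ) ^ (1 + b) := Real.self_le_rpow_of_one_le hn1 (by linarith)
      have h2 : (n : ℝ) ≤ (R : ℝ) := h1.trans (Nat.le_ceil _)
      exact_mod_cast h2
    have hR1 : 1 ≤ R := hn.trans hnR
    -- pointwise lower bound on `Λ_n`
    have hlow : ∀ y ∈ box 3 n, θ ^ 2 / 2 ≤ μ.real (openConnIn (↑(box 3 R) : Set (Site 3)) 0 y) := by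
      intro y hy
      have h1 := theta_sq_le_real_openConnIn_add_real_twoClusters (criticalProbI 3) hnR
        (zero_mem_box 3 n) hy
      have h2 := hN n hNn
      rw [← hμ, ← hθdef] at h1
      linarith
    have hsum : (((2 * n + 1) ^ 3 : ℕ) : ℝ) * (θ ^ 2 / 2) ≤
        ∑ y ∈ box 3 R, μ.real (openConnIn (↑(box 3 R) : Set (Site 3)) 0 y) := by
      calc (((2 * n + 1) ^ 3 : ℕ) : ℝ) * (θ ^ 2 / 2) = ∑ _y ∈ box 3 n, θ ^ 2 / 2 := by
            rw [Finset.sum_const, card_box, nsmul_eq_mul]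
        _ ≤ ∑ y ∈ box 3 n, μ.real (openConnIn (↑(box 3 R) : Set (Site 3)) 0 y) :=
            Finset.sum_le_sum hlow
        _ ≤ ∑ y ∈ box 3 R, μ.real (openConnIn (↑(box 3 R) : Set (Site 3)) 0 y) :=
            Finset.sum_le_sum_of_subset_of_nonneg (box_mono 3 hnR)
              fun _ _ _ => measureReal_nonneg
    exact hsum.trans ((hC R hR1).trans (hK n hn))
  -- contradiction: `n³ θ²/2 ≤ (2n+1)³ θ²/2 ≤ K n^s` with `s < 3`
  have htend : Tendsto (fun n : ℕ => ((n : ℝ)) ^ (3 - s)) atTop atTop :=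
    (tendsto_rpow_atTop (by linarith : (0 : ℝ) < 3 - s)).comp tendsto_natCast_atTop_atTop
  obtain ⟨n, hn⟩ := ((htend.eventually_gt_atTop (2 * K / θ ^ 2)).and
    ((eventually_ge_atTop N).and (eventually_ge_atTop 1))).exists
  obtain ⟨hbig, hNn, hn1⟩ := hn
  have hnpos : (0 : ℝ) < n := by exact_mod_cast hn1
  have hns : 0 < (n : ℝ) ^ s := Real.rpow_pos_of_pos hnpos s
  have h3 : (n : ℝ) ^ (3 : ℝ) = (n : ℝ) ^ (3 - s) * (n : ℝ) ^ s := by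
    rw [← Real.rpow_add hnpos, sub_add_cancel]
  have h3' : (n : ℝ) ^ (3 : ℝ) = ((n ^ 3 : ℕ) : ℝ) := by
    rw [show (3 : ℝ) = ((3 : ℕ) : ℝ) by norm_num, Real.rpow_natCast]
    push_cast
    rfl
  have hcube : ((n ^ 3 : ℕ) : ℝ) ≤ (((2 * n + 1) ^ 3 : ℕ) : ℝ) := by
    exact_mod_cast Nat.pow_le_pow_left (by omega : n ≤ 2 * n + 1) 3
  have hK' : 2 * K < θ ^ 2 * (n : ℝ) ^ (3 - s) := by
    have := (div_lt_iff₀ (by positivity : (0 : ℝ) < θ ^ 2)).1 hbig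
    linarith
  have hlt : K * (n : ℝ) ^ s < (((2 * n + 1) ^ 3 : ℕ) : ℝ) * (θ ^ 2 / 2) :=
    calc K * (n : ℝ) ^ s < (θ ^ 2 / 2 * (n : ℝ) ^ (3 - s)) * (n : ℝ) ^ s :=
          mul_lt_mul_of_pos_right (by linarith) hns
      _ = ((n ^ 3 : ℕ) : ℝ) * (θ ^ 2 / 2) := by rw [← h3', h3]; ring
      _ ≤ (((2 * n + 1) ^ 3 : ℕ) : ℝ) * (θ ^ 2 / 2) :=
          mul_le_mul_of_nonneg_right hcube hθ2.le
  exact absurd (hmain n hNn hn1) (not_le.2 hlt)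

end Summit.CriticalPhenomena.PercolationContinuityZ3.Theorems
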